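import Mathlib
import Summits.ValiantsHypothesis.ValiantsHypothesis.Theorems.DivisionGapZeroOneTransferFaceEngine
import Summits.ValiantsHypothesis.ValiantsHypothesis.Theorems.DivisionGapZeroOneTransferFaceIsolationForms
import Summits.ValiantsHypothesis.ValiantsHypothesis.Theorems.DivisionGapZeroOneTransferOffHoriz
import Summits.ValiantsHypothesis.ValiantsHypothesis.Theorems.DivisionGapZeroOneTransferTorusD
import Summits.ValiantsHypothesis.ValiantsHypothesis.Theorems.DivisionGapZeroOneTransferMmBlockFloor
import Summits.ValiantsHypothesis.ValiantsHypothesis.Theorems.DivisionGapZeroOneTransferStubBlockComplementCover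

/-!
# Crux `DivisionGap.ZeroOneTransfer` (stmt-ValiantsHypothesis-5066), line `charged-uncharged`, Part E-II
(lead c13): MM CERTIFICATES FOR `D_n` HAVE MANY MONOMIALS

Lead c12's necessity theory for uncharged certificates `X` of the decisive instance (`L₊(D_n · X)`
quasi-polynomial) does not exclude, e.g., the binomial `x^{u₁} + x^{u₂}` of two domino tilings (dense
monomials, margin-homogeneous, no monomial initial form in any `D_n`-degenerate direction).  This file
closes that hole:

* `fewMonomials_lower_bound` — `∃ κ, ∀` even `n`, even `m ≥ 64`, `X ≠ 0` with `2 · #supp X ≤ (n/m)²`,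
  `24L + 60 ≤ m`: `T^L ≤ 4 · ((n²+2)(L₊(D_n · X) + 3))^κ · (m²+1)² · (T-1)^L`.  Proof: torus WLOG
  (`stub_torusD`: a margin-homogeneous sub-sum `X₁` at no cost), off-horizontal rigidity
  (`stub_offHoriz_rigid`: two monomials of `X₁` differ on a NON-horizontal variable), lexicographic penalty
  isolation (`stub_isolate_offHoriz`: a weight `p` supported on `< #supp X₁` non-horizontal pairs `F` with a
  strict minimiser `û`), free BOTTOM form: `bot_p(D_n · X₁) = D_n[Avoid F] · (a x^û)`
  (`stub_botComponent_avoid_triPM`, `stub_botComponent_eq_monomial`; the horizontal-domino cover has penalty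
  `0`), an aligned block avoiding every end point of `F` (pigeonhole `exists_block_avoiding`), whose
  complement is covered by horizontal dominoes inside `Avoid F`, and the face engine `stub_faceEngine`.
* `not_mm_certificate_fewMonomials` — asymptotic form: no `c` admits, for every `n`, a nonzero `X_n` with at
  most `n` monomials and `L₊(D_n · X_n) ≤ 2^((log₂ n + c)^c)` (level `n = 2^(2j+1)`, block `2^j`,
  `(n/m)² = 2n`).
* `fewMonomials_lower_bound_top` — the same with `#supp (top_W X)` for any `D_n`-degenerate direction `W`;
  `not_mm_certificate_with_few_monomials` — the quasi-polynomial threshold form (`#supp X_n ≥ n²/qp`).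
* `not_triDivisionEasy_fewMonomials` — the same for the CHARGED crux 4: successful denominators of
  subtraction-free circuits with division for `D_n` have more than `n` monomials.
[cite: Valiant1980, §3 Thm 1] [cite: JuknaSeiwertSergeev2022, Lemma 2]
-/

noncomputable section

-- `Summit.ValiantsHypothesis.ValiantsHypothesis.…` is the tree's mandated single-conjunct layout
-- (Sub = Summit), so the duplicated namespace component is intended.
set_option linter.dupNamespace false

namespace Summit.ValiantsHypothesis.ValiantsHypothesis.Theorems.DivisionGapZeroOneTransfer

open MvPolynomial
open Literature.Computability.AlgebraicComplexity
open Summit.ValiantsHypothesis.ValiantsHypothesis.Theorems.TriangularDimersDivisionEasy.Negative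
open Summit.ValiantsHypothesis.ValiantsHypothesis.Theorems.ZeroOneTransfer
open FaceIsolation
open scoped NNReal BigOperators

namespace FewMonomials

variable {n : ℕ}

/-- The pair `(rowCover v, v)` is horizontal too. [folklore] -/
theorem isHoriz_rowCover_symm (hn : Even n) (v : Vtx n) : IsHoriz (rowCover hn v, v) := by
  obtain ⟨h1, h2⟩ := Forms.isHoriz_rowCover hn v
  refine ⟨h1.symm, ?_⟩
  rcases h2 with h | h
  · exact Or.inr h
  · exact Or.inl h

/-- The horizontal-domino cover of the complement of an aligned even block, inside `Avoid F` for any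
set `F` of non-horizontal pairs. [folklore] -/
theorem rowCover_complement (hn : Even n) {m : ℕ} (hme : Even m) (pp qq : ℕ) (F : Finset (Var n))
    (hF : ∀ e ∈ F, ¬ IsHoriz e) :
    ∃ g : Vtx n → Vtx n, ∀ v, ¬ InBlock (pp * m) (qq * m) m v →
      g (g v) = v ∧ g v ≠ v ∧ Adj v (g v) ∧ ¬ InBlock (pp * m) (qq * m) m (g v) ∧ Avoid F v (g v) := by
  refine ⟨rowCover hn, fun v hv => ?_⟩
  obtain ⟨h1, h2, h3⟩ := BlockComplementCover.rowCover_isDimer hn v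
  refine ⟨h1, h2, h3, ?_, ?_⟩
  · intro hin
    apply hv
    have hr : (rowCover hn v).1 = v.1 := rfl
    have hc : (rowCover hn v).2 = partner hn v.2 := rfl
    unfold InBlock at hin ⊢
    rw [hr, hc] at hin
    refine ⟨hin.1, hin.2.1, ?_⟩
    by_contra hcol
    exact BlockComplementCover.partner_not_mem_of_not_mem hn hme qq v.2 hcol ⟨hin.2.2.1, hin.2.2.2⟩
  · exact ⟨fun hmem => hF _ hmem (Forms.isHoriz_rowCover hn v),
      fun hmem => hF _ hmem (isHoriz_rowCover_symm hn v)⟩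

/-- Exponent bookkeeping: `κ (4j + 5 + (2j+1+c)^c) ≤ (j + (2c+8+2κ))^(2c+8+2κ)`. [folklore] -/
theorem kappa_bound (κ j c : ℕ) :
    κ * (4 * j + 5 + (2 * j + 1 + c) ^ c) ≤ (j + (2 * c + 8 + 2 * κ)) ^ (2 * c + 8 + 2 * κ) := by
  set B := j + (2 * c + 8 + 2 * κ) with hB
  have hB8 : 8 ≤ B := by omega
  have h1 : 4 * j + 5 ≤ B ^ 2 := by nlinarith
  have h2 : (2 * j + 1 + c) ^ c ≤ B ^ (2 * c) := by
    calc (2 * j + 1 + c) ^ c ≤ (B * B) ^ c := Nat.pow_le_pow_left (by nlinarith) c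
      _ = B ^ (2 * c) := by rw [← pow_two, ← pow_mul]
  have h3 : B ^ 2 ≤ B ^ (2 * c + 2) := Nat.pow_le_pow_right (by omega) (by omega)
  have h4 : B ^ (2 * c) ≤ B ^ (2 * c + 2) := Nat.pow_le_pow_right (by omega) (by omega)
  have h5 : 4 * j + 5 + (2 * j + 1 + c) ^ c ≤ 2 * B ^ (2 * c + 2) := by omega
  have h6 : 2 * κ ≤ B := by omega
  calc κ * (4 * j + 5 + (2 * j + 1 + c) ^ c) ≤ κ * (2 * B ^ (2 * c + 2)) := Nat.mul_le_mul_left _ h5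
    _ = (2 * κ) * B ^ (2 * c + 2) := by ring
    _ ≤ B * B ^ (2 * c + 2) := Nat.mul_le_mul_right _ h6
    _ = B ^ (2 * c + 3) := by ring
    _ ≤ B ^ (2 * c + 8 + 2 * κ) := Nat.pow_le_pow_right (by omega) (by omega)

/-- From `L₊(D_n · X) ≤ 2^((log₂ n + c)^c)` at `n = 2^(2j+1)`: the engine's quantity is at most
`2^((j + c')^c')` with `c' = 2c + 8 + 2κ`. [folklore] -/
theorem engine_quantity_le {κ c j : ℕ} {X : MvPolynomial (Var (2 ^ (2 * j + 1))) ℝ≥0}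
    (h : complexity (triPM (2 ^ (2 * j + 1)) * X) ≤ bound c (2 ^ (2 * j + 1))) :
    ((2 ^ (2 * j + 1) * 2 ^ (2 * j + 1) + 2) * (complexity (triPM (2 ^ (2 * j + 1)) * X) + 3)) ^ κ ≤
      2 ^ ((j + (2 * c + 8 + 2 * κ)) ^ (2 * c + 8 + 2 * κ)) := by
  have hlog : Nat.log 2 (2 ^ (2 * j + 1)) = 2 * j + 1 := Nat.log_pow (by norm_num) _
  unfold bound at h
  rw [hlog] at h
  have h1 : 2 ^ (2 * j + 1) * 2 ^ (2 * j + 1) + 2 ≤ 2 ^ (4 * j + 3) := by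
    have e : 2 ^ (2 * j + 1) * 2 ^ (2 * j + 1) = 2 ^ (4 * j + 2) := by rw [← pow_add]; ring_nf
    have e2 : 2 ^ (4 * j + 3) = 2 ^ (4 * j + 2) * 2 := by rw [← pow_succ]
    have : 2 ≤ 2 ^ (4 * j + 2) := by
      calc 2 = 2 ^ 1 := by norm_num
        _ ≤ 2 ^ (4 * j + 2) := Nat.pow_le_pow_right (by norm_num) (by omega)
    rw [e, e2]
    omega
  have h2 : complexity (triPM (2 ^ (2 * j + 1)) * X) + 3 ≤ 2 ^ ((2 * j + 1 + c) ^ c + 2) := by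
    have e3 : 2 ^ ((2 * j + 1 + c) ^ c + 2) = 2 ^ ((2 * j + 1 + c) ^ c) * 4 := by rw [pow_add]; norm_num
    have : 1 ≤ 2 ^ ((2 * j + 1 + c) ^ c) := Nat.one_le_two_pow
    rw [e3]
    omega
  calc ((2 ^ (2 * j + 1) * 2 ^ (2 * j + 1) + 2) * (complexity (triPM (2 ^ (2 * j + 1)) * X) + 3)) ^ κ
      ≤ (2 ^ (4 * j + 3) * 2 ^ ((2 * j + 1 + c) ^ c + 2)) ^ κ := Nat.pow_le_pow_left (Nat.mul_le_mul h1 h2) κ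
    _ = 2 ^ (κ * (4 * j + 5 + (2 * j + 1 + c) ^ c)) := by
        rw [← pow_add, ← pow_mul]; congr 1; ring
    _ ≤ 2 ^ ((j + (2 * c + 8 + 2 * κ)) ^ (2 * c + 8 + 2 * κ)) :=
        Nat.pow_le_pow_right (by norm_num) (kappa_bound κ j c)

end FewMonomials

open FewMonomials

/-- **Rung E-II: CERTIFICATES HAVE MANY MONOMIALS.**  For even `n`, even `m ≥ 64`, `24L + 60 ≤ m`, and
any nonzero `X` with `2 · #supp X ≤ (n/m)²`:
`T^L ≤ 4 · ((n²+2)(L₊(D_n · X) + 3))^κ · (m²+1)² · (T-1)^L`.  Torus WLOG, off-horizontal rigidity,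
lexicographic penalty isolation on `< #supp X` non-horizontal pairs, free bottom form, the face engine on
an aligned block avoiding the penalised pairs (complement covered by horizontal dominoes, which avoid
non-horizontal pairs). [cite: Valiant1980, §3 Thm 1] [cite: JuknaSeiwertSergeev2022, Lemma 2] -/
theorem fewMonomials_lower_bound : ∃ κ : ℕ, ∀ (n m : ℕ), Even n → 64 ≤ m → Even m →
    ∀ X : MvPolynomial (Var n) ℝ≥0, X ≠ 0 → 2 * X.support.card ≤ (n / m) * (n / m) →
    ∀ L : ℕ, 24 * L + 60 ≤ m →
      Tfib ^ L ≤ 4 * ((n * n + 2) * (complexity (triPM n * X) + 3)) ^ κ * (m * m + 1) ^ 2 *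
        (Tfib - 1) ^ L := by
  obtain ⟨κ, hκ⟩ := stub_faceEngine
  refine ⟨κ, fun n m hn h64 hme X hX hK L hL => ?_⟩
  classical
  obtain ⟨X₁, hX₁0, hsupp, hmarg, hcx1⟩ := stub_torusD n X hX
  have hrig : ∀ u ∈ X₁.support, ∀ u' ∈ X₁.support, (∀ e : Var n, ¬ IsHoriz e → u e = u' e) → u = u' :=
    fun u hu u' hu' h => stub_offHoriz_rigid n u u' (hmarg u hu u' hu').1 (hmarg u hu u' hu').2 h
  obtain ⟨F, p, û, hû, hFcard, hFnh, hppos, hpzero, hmin⟩ :=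
    stub_isolate_offHoriz n X₁.support (support_nonempty.2 hX₁0) hrig
  have hbotX : ProjClosure.botComponent p X₁ = monomial û (coeff û X₁) :=
    stub_botComponent_eq_monomial n p X₁ û hû hmin
  have hbotD : ProjClosure.botComponent p (triPM n) = triPMIn (Avoid F) :=
    stub_botComponent_avoid_triPM n F p hn hFnh hppos hpzero
  have hbot : ProjClosure.botComponent p (triPM n * X₁) = triPMIn (Avoid F) * monomial û (coeff û X₁) := by
    rw [ProjClosure.botComponent_mul, hbotD, hbotX]
  have hcx : complexity (triPMIn (Avoid F) * monomial û (coeff û X₁)) ≤ complexity (triPM n * X) := by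
    rw [← hbot]; exact (ProjClosure.complexity_botComponent_le _ _).trans hcx1
  -- an aligned block avoiding every end point of `F`
  set S : Finset (Vtx n) := F.image Prod.fst ∪ F.image Prod.snd with hSdef
  have hS : S.card < (n / m) * (n / m) := by
    have h1 : S.card ≤ F.card + F.card :=
      (Finset.card_union_le _ _).trans (add_le_add Finset.card_image_le Finset.card_image_le)
    have h2 : X₁.support.card ≤ X.support.card := Finset.card_le_card hsupp
    omega
  obtain ⟨pp, qq, hp, hq, havoid⟩ := MmBlockFloor.exists_block_avoiding S hS
  have hk : (n / m) * m ≤ n := Nat.div_mul_le_self n m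
  have hpm : pp * m + m ≤ n := by nlinarith
  have hqm : qq * m + m ≤ n := by nlinarith
  have hblk : ∀ v w : Vtx n, InBlock (pp * m) (qq * m) m v → InBlock (pp * m) (qq * m) m w → Adj v w →
      Avoid F v w := by
    intro v w hv _ _
    have hv' : (pp * m ≤ (v.1 : ℕ) ∧ (v.1 : ℕ) < pp * m + m) ∧ (qq * m ≤ (v.2 : ℕ) ∧ (v.2 : ℕ) < qq * m + m) :=
      ⟨⟨hv.1, hv.2.1⟩, ⟨hv.2.2.1, hv.2.2.2⟩⟩
    refine ⟨fun hvw => ?_, fun hwv => ?_⟩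
    · exact havoid v (Finset.mem_union_left _ (Finset.mem_image.2 ⟨(v, w), hvw, rfl⟩)) hv'
    · exact havoid v (Finset.mem_union_right _ (Finset.mem_image.2 ⟨(w, v), hwv, rfl⟩)) hv'
  have hg := rowCover_complement hn hme pp qq F hFnh
  have key := hκ n (Avoid F) û (coeff û X₁) (mem_support_iff.1 hû) (pp * m) (qq * m) m h64 hme hpm hqm
    hblk hg L hL
  calc Tfib ^ L ≤ 4 * ((n * n + 2) * (complexity (triPMIn (Avoid F) * monomial û (coeff û X₁)) + 3)) ^ κ *
        (m * m + 1) ^ 2 * (Tfib - 1) ^ L := key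
    _ ≤ 4 * ((n * n + 2) * (complexity (triPM n * X) + 3)) ^ κ * (m * m + 1) ^ 2 * (Tfib - 1) ^ L := by
      gcongr


/-- **Rung E-II along any `D_n`-degenerate direction.**  Top forms are free and multiplicative, so the
monomial count that matters is that of the top form of `X` in ANY direction `W` along which `D_n` is
homogeneous (row / column / non-edge weights and their sums): if `2 · #supp (top_W X) ≤ (n/m)²` the same
bound holds. [cite: Valiant1980, §3 Thm 1] [cite: JuknaSeiwertSergeev2022, Lemma 2] -/
theorem fewMonomials_lower_bound_top : ∃ κ : ℕ, ∀ (n m : ℕ), Even n → 64 ≤ m → Even m →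
    ∀ (X : MvPolynomial (Var n) ℝ≥0) (W : Var n → ℕ) (d : ℕ),
      MvPolynomial.IsWeightedHomogeneous W (triPM n) d → X ≠ 0 →
      2 * (Negative.topComponent W X).support.card ≤ (n / m) * (n / m) →
    ∀ L : ℕ, 24 * L + 60 ≤ m →
      Tfib ^ L ≤ 4 * ((n * n + 2) * (complexity (triPM n * X) + 3)) ^ κ * (m * m + 1) ^ 2 *
        (Tfib - 1) ^ L := by
  obtain ⟨κ, hκ⟩ := fewMonomials_lower_bound
  refine ⟨κ, fun n m hn h64 hme X W d hhom hX hK L hL => ?_⟩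
  have hX' : Negative.topComponent W X ≠ 0 := Negative.topComponent_ne_zero W hX
  have key := hκ n m hn h64 hme (Negative.topComponent W X) hX' hK L hL
  have htop : Negative.topComponent W (triPM n * X) = triPM n * Negative.topComponent W X := by
    rw [Negative.topComponent_mul, Negative.topComponent_eq_self_of_isWeightedHomogeneous W hhom]
  have hcx : complexity (triPM n * Negative.topComponent W X) ≤ complexity (triPM n * X) := by
    rw [← htop]; exact Negative.complexity_topComponent_le _ _
  calc Tfib ^ L ≤ 4 * ((n * n + 2) * (complexity (triPM n * Negative.topComponent W X) + 3)) ^ κ *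
        (m * m + 1) ^ 2 * (Tfib - 1) ^ L := key
    _ ≤ 4 * ((n * n + 2) * (complexity (triPM n * X) + 3)) ^ κ * (m * m + 1) ^ 2 * (Tfib - 1) ^ L := by
      gcongr

/-- **No MM certificate for `D_n` with at most `n` monomials** (asymptotic form of rung E-II): no
constant `c` admits, for every `n`, a nonzero `X_n` with `#supp X_n ≤ n` and
`L₊(D_n · X_n) ≤ 2^((log₂ n + c)^c)`.  At the level `n = 2^(2j+1)` take the block side `m = 2^j`, so
`(n/m)² = 2n ≥ 2 · #supp X`. [cite: Valiant1980, §3 Thm 1] [cite: JuknaSeiwertSergeev2022, Lemma 2] -/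
theorem not_mm_certificate_fewMonomials :
    ¬ ∃ c : ℕ, ∀ n : ℕ, ∃ X : MvPolynomial (Var n) ℝ≥0,
      X ≠ 0 ∧ X.support.card ≤ n ∧ complexity (triPM n * X) ≤ bound c n := by
  rintro ⟨c, H⟩
  obtain ⟨κ, hκ⟩ := fewMonomials_lower_bound
  obtain ⟨j, hj6, hviol⟩ := exists_m_violating (2 * c + 8 + 2 * κ)
  have h64 : 64 ≤ 2 ^ j := by
    calc 64 = 2 ^ 6 := by norm_num
      _ ≤ 2 ^ j := Nat.pow_le_pow_right (by norm_num) hj6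
  have hn : Even (2 ^ (2 * j + 1)) := Nat.even_pow.2 ⟨even_two, by omega⟩
  have hme : Even (2 ^ j) := Nat.even_pow.2 ⟨even_two, by omega⟩
  have hdiv : 2 ^ (2 * j + 1) / 2 ^ j = 2 ^ (j + 1) := by
    rw [Nat.pow_div (by omega) (by norm_num)]
    congr 1
    omega
  obtain ⟨X, hX0, hcard, hle⟩ := H (2 ^ (2 * j + 1))
  have hK : 2 * X.support.card ≤ (2 ^ (2 * j + 1) / 2 ^ j) * (2 ^ (2 * j + 1) / 2 ^ j) := by
    rw [hdiv, ← pow_add]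
    have e : 2 ^ (j + 1 + (j + 1)) = 2 * 2 ^ (2 * j + 1) := by
      rw [show j + 1 + (j + 1) = (2 * j + 1) + 1 by ring, pow_succ]; ring
    rw [e]
    omega
  have hlb : ∀ L, 24 * L + 60 ≤ 2 ^ j →
      Tfib ^ L ≤ 4 * ((2 ^ (2 * j + 1) * 2 ^ (2 * j + 1) + 2) *
        (complexity (triPM (2 ^ (2 * j + 1)) * X) + 3)) ^ κ *
        (2 ^ j * 2 ^ j + 1) ^ 2 * (Tfib - 1) ^ L :=
    fun L hL => hκ (2 ^ (2 * j + 1)) (2 ^ j) hn h64 hme X hX0 hK L hL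
  have hF := engine_quantity_le (κ := κ) hle
  have hkey := key_ineq_of_bound hj6 hlb hF
  exact absurd (hkey.trans_lt hviol) (lt_irrefl _)


/-- **MM certificates for `D_n` have `≥ n² / 2^((log₂ n + c)^c)` monomials** (the quasi-polynomial
threshold form, cf. Part D-I's `not_mm_certificate_with_sparse_monomial` for variables per monomial): no
constant `c` admits, for every `n`, a nonzero `X_n` with `#supp X_n · 2^((log₂ n + c)^c) < n²` and
`L₊(D_n · X_n) ≤ 2^((log₂ n + c)^c)`. [cite: Valiant1980, §3 Thm 1] [cite: JuknaSeiwertSergeev2022, Lemma 2] -/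
theorem not_mm_certificate_with_few_monomials :
    ¬ ∃ c : ℕ, ∀ n : ℕ, ∃ X : MvPolynomial (Var n) ℝ≥0,
      X ≠ 0 ∧ X.support.card * bound c n < n * n ∧ complexity (triPM n * X) ≤ bound c n := by
  rintro ⟨c, H⟩
  rcases Nat.eq_zero_or_pos c with rfl | hc
  · -- `c = 0`: the bound is `2`, but `D_n · X` has `n²` variables
    obtain ⟨X, hX0, -, hle⟩ := H 8
    have hb : bound 0 8 = 2 := by unfold bound; simp
    rw [hb] at hle
    have hn : Even 8 := by decide
    have hsq := MmBlockFloor.sq_le_complexity_triPM_mul hn hX0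
    omega
  · refine not_mm_certificate_fewMonomials ⟨c, fun n => ?_⟩
    obtain ⟨X, hX0, hfew, hle⟩ := H n
    refine ⟨X, hX0, ?_, hle⟩
    -- `bound c n > n`, so `#supp X · bound < n²` forces `#supp X ≤ n`
    have hbig : n < bound c n := by
      unfold bound
      have h1 : n < 2 ^ (Nat.log 2 n + 1) := Nat.lt_pow_succ_log_self (by norm_num) n
      have h2 : Nat.log 2 n + 1 ≤ (Nat.log 2 n + c) ^ c :=
        (by omega : Nat.log 2 n + 1 ≤ Nat.log 2 n + c).trans (Nat.le_self_pow (by omega) _)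
      exact h1.trans_le (Nat.pow_le_pow_right (by norm_num) h2)
    by_contra hK
    push Not at hK
    have : n * n < X.support.card * bound c n :=
      calc n * n < n * bound c n + 1 * 1 := by nlinarith
        _ ≤ X.support.card * bound c n := by nlinarith
    omega

/-- **Crux 4 needs denominators with more than `n` monomials.**  In the Hrubeš–Yehudayoff normal form
`D_n · h = g` of a subtraction-free circuit with division for `D_n`, no family of nonzero denominators `h_n`
with at most `n` monomials achieves `L₊(D_n · h_n) + L₊(h_n) ≤ 2^((log₂ n + c)^c)` (drop the charge
`L₊(h)` and apply `not_mm_certificate_fewMonomials`). [cite: Valiant1980, §3 Thm 1]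
[cite: JuknaSeiwertSergeev2022, Lemma 2] -/
theorem not_triDivisionEasy_fewMonomials :
    ¬ ∃ c : ℕ, ∀ n : ℕ, ∃ h : MvPolynomial (Var n) ℝ≥0,
      h ≠ 0 ∧ h.support.card ≤ n ∧ complexity (triPM n * h) + complexity h ≤ bound c n := by
  rintro ⟨c, H⟩
  refine not_mm_certificate_fewMonomials ⟨c, fun n => ?_⟩
  obtain ⟨h, h0, hcard, hle⟩ := H n
  exact ⟨h, h0, hcard, le_of_add_le_left hle⟩

end Summit.ValiantsHypothesis.ValiantsHypothesis.Theorems.DivisionGapZeroOneTransfer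

end
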